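import Summits.CriticalPhenomena.PercolationContinuityZ3.Theorems.SoloInformedSlabBoxFace
import HarnessLib

/-!
# Blocking mass across disjoint annuli (solo-informed, session 18)

Sub-problem `Summit.CriticalPhenomena.PercolationContinuityZ3` (`θ(p_c) = 0` on `ℤ³`).
Paper `paper/sharpest-statement.md`, §2 (S20) and §7b.3 (d5).

For a strictly increasing scale sequence `s₀ < s₁ < ⋯` the annuli `Λ(s_{i+1}) ∖ Λ(s_i)` are
pairwise disjoint, and the events

  `annCross (s i) (s (i+1))` = "`∂ⁱⁿΛ(s_{i+1})` is joined to the shell `Λ(s_i + 1) ∖ Λ(s_i)` by an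
  open path INSIDE the annulus `Λ(s_{i+1}) ∖ Λ(s_i)`"

read pairwise disjoint sets of edges, hence are independent under `P_p`.  An infinite open path
from `Λ(s₀)` crosses every annulus (`boxCrossing_subset_annCross`: follow an open path from
`∂ⁱⁿΛ(b)` to `Λ(a)` inside `Λ(b)` down to its first entrance into `Λ(a)`), so

* `theta_le_prod_annCross` — **`θ(p) ≤ ∏_{i<j} P_p(annCross (s i) (s (i+1)))`** for every `j`;
* `theta_eq_zero_of_prod_annCross_tendsto_zero` — `θ(p) = 0` as soon as these products tend to `0`;
* `sum_blocking_le_neg_log_theta`, `summable_blocking_of_theta_pos` — **in a jump world the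
  blocking mass is summable**: if `θ(p) > 0` then for every strictly increasing `s`,
  `∑_{i<j} (1 - P_p(annCross (s i) (s (i+1)))) ≤ -log θ(p)` for all `j`, so the blocking
  probabilities of ANY sequence of disjoint annuli are summable with total mass `≤ log (1/θ(p))`
  (portrait item S20: not only do the crossing deficits of row (Y) tend to `0` in the jump world
  (S19), their sum over all dyadic — or any nested — scales is at most `log(1/θ(p_c))`);
* `percolationContinuity_of_not_summable_blocking` — contrapositively, **the conjunct follows from
  ONE scale sequence along which the annulus-blocking probabilities at `p_c` are not summable**
  (the product form of the equivalent face 19; with a FIXED ratio `s_{i+1} = k s_i` it is the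
  RSW-type face (Y_k) weakened from "`≥ δ` infinitely often" to "not summable").

Since `boxCrossing d (a+1) b ⊇ annCross a b ⊇ boxCrossing d a b`, every statement transfers to the
row-(Y) events `Λ(n) ↔ ∂ⁱⁿΛ(N) in Λ(N)` up to a shift of the inner radius by one
(`sum_boxCrossing_deficit_le_neg_log_theta`).  Elementary (product measure, Grimmett 1999 §2.2;
`1 - x ≤ e^{-x}`). [folklore]
-/

noncomputable section

namespace Summit.CriticalPhenomena.PercolationContinuityZ3.Theorems

open MeasureTheory ProbabilityTheory Filter Topology
open Literature.Probability.Percolation Literature.Probability.LatticeModels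
open Literature.Probability.Percolation.CerfDembinVanishing
open scoped ENNReal

namespace SurfaceTension

variable {d : ℕ}

/-! ## Annuli and the annulus-crossing event -/

/-- The annulus `Λ(b) ∖ Λ(a)` as a set of sites. -/
def annulus (a b : ℕ) : Set (Site d) := {x | x ∈ box d b ∧ x ∉ box d a}

/-- `annCross a b`: `∂ⁱⁿΛ(b)` is joined to the shell `Λ(a+1) ∖ Λ(a)` by an open path inside the
annulus `Λ(b) ∖ Λ(a)`. -/
def annCross (a b : ℕ) : Set (BondConfig (Site d)) :=
  linked (annulus a b) ↑(innerBoundary (zdGraph d) (box d b)) (annulus a (a + 1))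

/-- `annCross` is measurable. -/
theorem measurableSet_annCross (a b : ℕ) : MeasurableSet (annCross (d := d) a b) :=
  measurableSet_linked _ _ _

/-- `annCross a b` only reads the edges inside the annulus. -/
theorem determinedBy_annCross (a b : ℕ) :
    DeterminedBy (annCross (d := d) a b) (withinGraph (zdGraph d) (annulus a b)).edgeSet :=
  determinedBy_linked _ _ _

/-- The edges inside a region grow with the region. -/
theorem edgeSet_withinGraph_mono {R R' : Set (Site d)} (h : R ⊆ R') :
    (withinGraph (zdGraph d) R).edgeSet ⊆ (withinGraph (zdGraph d) R').edgeSet := by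
  intro e he
  induction e using Sym2.ind with
  | h u v =>
    rw [mem_edgeSet_withinGraph] at he ⊢
    exact ⟨he.1, h he.2.1, h he.2.2⟩

/-- An annulus lies inside its outer box. -/
theorem annulus_subset_box (a b : ℕ) : annulus (d := d) a b ⊆ ↑(box d b) :=
  fun _ hx => Finset.mem_coe.2 hx.1

/-- An annulus is disjoint from every box inside its hole. -/
theorem disjoint_annulus_box {a b c : ℕ} (h : c ≤ a) :
    Disjoint (annulus (d := d) a b) ↑(box d c) :=
  Set.disjoint_left.2 fun _ hx hc => hx.2 (box_mono d h (Finset.mem_coe.1 hc))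

/-! ## An annulus crossing is read inside the annulus -/

/-- **Localisation.** For `a < b`, `boxCrossing d a b ⊆ annCross a b`: follow an open path from
`∂ⁱⁿΛ(b)` to `Λ(a)` inside `Λ(b)` down to its first entrance into `Λ(a)`; the segment before the
entrance lies in `Λ(b) ∖ Λ(a)` and ends in the shell `Λ(a+1) ∖ Λ(a)`. -/
theorem boxCrossing_subset_annCross {a b : ℕ} (hab : a < b) :
    boxCrossing d a b ⊆ annCross a b := by
  intro ω hω
  rw [boxCrossing_eq_linked, mem_linked_iff] at hω
  obtain ⟨v, hv, x, hx, hvx⟩ := hω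
  rw [Finset.mem_coe] at hv hx
  -- `v ∉ Λ(a)`: one coordinate of `v` is `± b`
  have hva : v ∉ box d a := by
    intro hva
    obtain ⟨i, hi⟩ := exists_eq_of_mem_innerBoundary_box hv
    have h1 := (mem_box.1 hva) i
    rcases hi with hi | hi <;> rw [hi] at h1 <;> omega
  rw [mem_inConn_iff] at hvx
  obtain ⟨W⟩ := hvx
  set R : Set (Site d) := {y | y ∉ box d a} with hR
  obtain ⟨b', c', hb'R, hc'R, hadj, hreach⟩ :=
    exists_exit_of_walk (G := zdGraph d)
      (H := openGraph ω ⊓ withinGraph (zdGraph d) ↑(box d b))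
      (inf_le_right.trans (withinGraph_le _ _)) R W hva (fun h => h hx)
  have hwithin := withinGraph_adj.1 ((SimpleGraph.inf_adj _ _ _ _).1 hadj).2
  -- `hwithin : (zdGraph d).Adj b' c' ∧ b' ∈ ↑(box d b) ∧ c' ∈ ↑(box d b)`
  simp only [hR, Set.mem_setOf_eq, not_not] at hb'R hc'R
  -- `c' ∈ Λ(a)`, so `b' ∈ Λ(a+1) ∖ Λ(a)`
  have hb'1 : b' ∈ box d (a + 1) := by
    rw [mem_box]
    intro i
    have h1 := (mem_box.1 hc'R) i
    have h2 := coord_sub_le_one_of_adj hwithin.1 i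
    push_cast
    constructor <;> omega
  have hb'A : b' ∈ annulus (d := d) a (a + 1) := ⟨hb'1, hb'R⟩
  -- the path from `v` to `b'` lies in the annulus
  have hle : (openGraph ω ⊓ withinGraph (zdGraph d) ↑(box d b)) ⊓ withinGraph (zdGraph d) R ≤
      openGraph ω ⊓ withinGraph (zdGraph d) (annulus a b) := by
    intro u w huw
    rw [SimpleGraph.inf_adj, SimpleGraph.inf_adj, withinGraph_adj, withinGraph_adj] at huw
    rw [SimpleGraph.inf_adj, withinGraph_adj]
    obtain ⟨⟨ho, hG, hu, hw⟩, -, huR, hwR⟩ := huw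
    exact ⟨ho, hG, ⟨Finset.mem_coe.1 hu, huR⟩, ⟨Finset.mem_coe.1 hw, hwR⟩⟩
  exact mem_linked_iff.2
    ⟨v, Finset.mem_coe.2 hv, b', hb'A, mem_inConn_iff.2 (hreach.mono hle)⟩

/-- Conversely `annCross a b ⊆ boxCrossing d (a+1) b` (`a + 1 ≤ b`): the shell lies in `Λ(a+1)`. -/
theorem annCross_subset_boxCrossing {a b : ℕ} (hab : a + 1 ≤ b) :
    annCross a b ⊆ boxCrossing d (a + 1) b := by
  intro ω hω
  rw [annCross, mem_linked_iff] at hω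
  obtain ⟨v, hv, x, hx, hvx⟩ := hω
  rw [boxCrossing_eq_linked, mem_linked_iff]
  refine ⟨v, hv, x, Finset.mem_coe.2 hx.1, ?_⟩
  rw [mem_inConn_iff] at hvx ⊢
  refine hvx.mono ?_
  have _ := hab
  exact inf_le_inf_left _ (withinGraph_mono _ (annulus_subset_box a b))

/-! ## Independence across disjoint annuli -/

/-- **Product formula.** For a strictly increasing scale sequence `s`, the crossing events of the
annuli `Λ(s (i+1)) ∖ Λ(s i)`, `i < j`, are independent:
`P_p(⋂_{i<j} annCross (s i) (s (i+1))) = ∏_{i<j} P_p(annCross (s i) (s (i+1)))`. -/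
theorem real_biInter_annCross (p : unitInterval) {s : ℕ → ℕ} (hs : StrictMono s) (j : ℕ) :
    (bondPercolation (zdGraph d) p).real (⋂ i ∈ Finset.range j, annCross (s i) (s (i + 1))) =
      ∏ i ∈ Finset.range j, (bondPercolation (zdGraph d) p).real (annCross (s i) (s (i + 1))) := by
  induction j with
  | zero => simp [probReal_univ]
  | succ j ih =>
    rw [Finset.range_add_one, Finset.set_biInter_insert, Finset.prod_insert Finset.notMem_range_self,
      ← ih]
    -- the earlier annuli are read inside `Λ(s j)`, the new one outside it
    have hdet : DeterminedBy (⋂ i ∈ Finset.range j, annCross (d := d) (s i) (s (i + 1)))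
        (withinGraph (zdGraph d) ↑(box d (s j))).edgeSet := by
      rw [determinedBy_iff]
      intro ω ω' hω
      simp only [Set.mem_iInter]
      refine forall₂_congr fun i hi => ?_
      have hij : s (i + 1) ≤ s j := hs.monotone (Nat.succ_le_of_lt (Finset.mem_range.1 hi))
      exact (determinedBy_iff _ _).1
        ((determinedBy_annCross (s i) (s (i + 1))).mono
          (edgeSet_withinGraph_mono ((annulus_subset_box _ _).trans
            (Finset.coe_subset.2 (box_mono d hij)))))
        ω ω' hω
    exact bondPercolation_real_inter_of_disjoint (zdGraph d) p
      (disjoint_edgeSet_withinGraph (disjoint_annulus_box le_rfl))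
      (determinedBy_annCross (s j) (s (j + 1))) hdet (measurableSet_annCross _ _)
      (Finset.measurableSet_biInter _ fun i _ => measurableSet_annCross _ _)

/-! ## `θ` against the product -/

/-- **`θ(p) ≤ ∏_{i<j} P_p(annCross (s i) (s (i+1)))`** for every strictly increasing scale sequence
`s` and every `j`: the infinite open path from the origin crosses every annulus. -/
theorem theta_le_prod_annCross (p : unitInterval) {s : ℕ → ℕ} (hs : StrictMono s) (j : ℕ) :
    theta (zdGraph d) 0 p ≤
      ∏ i ∈ Finset.range j, (bondPercolation (zdGraph d) p).real (annCross (s i) (s (i + 1))) := by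
  rw [← real_biInter_annCross p hs j]
  have hae : ∀ᵐ ω ∂(bondPercolation (zdGraph d) p), ω ⊆ (zdGraph d).edgeSet :=
    setBernoulli_ae_subset
  have h1 : (percolatesAt (0 : Site d) : Set (BondConfig (Site d))) ⊆ boxToInfinity d (s 0) :=
    fun ω hω => ⟨0, zero_mem_box d _, hω⟩
  calc theta (zdGraph d) 0 p
      = (bondPercolation (zdGraph d) p).real (percolatesAt (0 : Site d)) := rfl
    _ ≤ (bondPercolation (zdGraph d) p).real (boxToInfinity d (s 0)) := measureReal_mono h1
    _ ≤ (bondPercolation (zdGraph d) p).real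
          (⋂ i ∈ Finset.range j, annCross (s i) (s (i + 1))) := by
        simp only [measureReal_def]
        refine ENNReal.toReal_mono (measure_ne_top _ _) (measure_mono_ae ?_)
        filter_upwards [hae] with ω hω h
        show ω ∈ ⋂ i ∈ Finset.range j, annCross (s i) (s (i + 1))
        exact Set.mem_iInter₂.2 fun i _ =>
          boxCrossing_subset_annCross (hs (Nat.lt_succ_self i))
            (mem_boxCrossing_of_mem_boxToInfinity (hs (Nat.lt_succ_self i)).le hω
              (boxToInfinity_mono (hs.monotone (Nat.zero_le i)) h))

/-- Hence `θ(p) = 0` as soon as the products tend to `0` along ONE scale sequence. -/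
theorem theta_eq_zero_of_prod_annCross_tendsto_zero (p : unitInterval) {s : ℕ → ℕ}
    (hs : StrictMono s)
    (h : Tendsto (fun j => ∏ i ∈ Finset.range j,
      (bondPercolation (zdGraph d) p).real (annCross (s i) (s (i + 1)))) atTop (𝓝 0)) :
    theta (zdGraph d) 0 p = 0 :=
  le_antisymm (ge_of_tendsto' h fun j => theta_le_prod_annCross p hs j) measureReal_nonneg

/-! ## Blocking mass -/

/-- The blocking probability of the `i`-th annulus of the scale sequence `s`. -/
def blocking (p : unitInterval) (s : ℕ → ℕ) (i : ℕ) : ℝ :=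
  1 - (bondPercolation (zdGraph d) p).real (annCross (d := d) (s i) (s (i + 1)))

/-- Blocking probabilities are nonnegative. -/
theorem blocking_nonneg (p : unitInterval) (s : ℕ → ℕ) (i : ℕ) : 0 ≤ blocking (d := d) p s i := by
  have : (bondPercolation (zdGraph d) p).real (annCross (d := d) (s i) (s (i + 1))) ≤ 1 :=
    measureReal_le_one
  unfold blocking; linarith

/-- Blocking probabilities are at most one. -/
theorem blocking_le_one (p : unitInterval) (s : ℕ → ℕ) (i : ℕ) : blocking (d := d) p s i ≤ 1 := by
  have : 0 ≤ (bondPercolation (zdGraph d) p).real (annCross (d := d) (s i) (s (i + 1))) :=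
    measureReal_nonneg
  unfold blocking; linarith

/-- `θ(p) ≤ exp (-(∑_{i<j} blocking_i))`, from `1 - x ≤ e^{-x}`. -/
theorem theta_le_exp_neg_sum_blocking (p : unitInterval) {s : ℕ → ℕ} (hs : StrictMono s) (j : ℕ) :
    theta (zdGraph d) 0 p ≤ Real.exp (-(∑ i ∈ Finset.range j, blocking (d := d) p s i)) := by
  refine (theta_le_prod_annCross p hs j).trans ?_
  rw [← Finset.sum_neg_distrib, Real.exp_sum]
  refine Finset.prod_le_prod (fun i _ => measureReal_nonneg) fun i _ => ?_
  have h := Real.add_one_le_exp (-(blocking (d := d) p s i))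
  unfold blocking at h ⊢
  linarith

/-- **Summable blocking in a jump world (partial sums).** If `θ(p) > 0` then for every strictly
increasing scale sequence and every `j`, `∑_{i<j} (1 - P_p(annCross (s i) (s (i+1)))) ≤ -log θ(p)`. -/
theorem sum_blocking_le_neg_log_theta (p : unitInterval) {s : ℕ → ℕ} (hs : StrictMono s)
    (hθ : 0 < theta (zdGraph d) 0 p) (j : ℕ) :
    ∑ i ∈ Finset.range j, blocking (d := d) p s i ≤ -Real.log (theta (zdGraph d) 0 p) := by
  have h := theta_le_exp_neg_sum_blocking (d := d) p hs j
  have hlog := (Real.log_le_iff_le_exp hθ).2 h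
  linarith

/-- **Summable blocking in a jump world.** If `θ(p) > 0` then along every strictly increasing
scale sequence the blocking probabilities are summable, with total mass `≤ -log θ(p)`. -/
theorem summable_blocking_of_theta_pos (p : unitInterval) {s : ℕ → ℕ} (hs : StrictMono s)
    (hθ : 0 < theta (zdGraph d) 0 p) :
    Summable (blocking (d := d) p s) ∧
      ∑' i, blocking (d := d) p s i ≤ -Real.log (theta (zdGraph d) 0 p) :=
  ⟨summable_of_sum_range_le (blocking_nonneg p s) (sum_blocking_le_neg_log_theta p hs hθ),
    Real.tsum_le_of_sum_range_le (blocking_nonneg p s) (sum_blocking_le_neg_log_theta p hs hθ)⟩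

/-- The same in terms of the row-(Y) events: if `θ(p) > 0` then for every scale sequence with
`s i + 1 ≤ s (i+1)` and every `j`,
`∑_{i<j} (1 - P_p(Λ(s i + 1) ↔ ∂ⁱⁿΛ(s (i+1)) in Λ(s (i+1)))) ≤ -log θ(p)`. -/
theorem sum_boxCrossing_deficit_le_neg_log_theta (p : unitInterval) {s : ℕ → ℕ} (hs : StrictMono s)
    (hgap : ∀ i, s i + 1 ≤ s (i + 1)) (hθ : 0 < theta (zdGraph d) 0 p) (j : ℕ) :
    ∑ i ∈ Finset.range j,
        (1 - (bondPercolation (zdGraph d) p).real (boxCrossing d (s i + 1) (s (i + 1)))) ≤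
      -Real.log (theta (zdGraph d) 0 p) := by
  refine le_trans (Finset.sum_le_sum fun i _ => ?_) (sum_blocking_le_neg_log_theta p hs hθ j)
  unfold blocking
  have := measureReal_mono (μ := bondPercolation (zdGraph d) p)
    (annCross_subset_boxCrossing (d := d) (hgap i))
  linarith

/-! ## The conjunct from one non-summable scale sequence -/

/-- **Non-summable blocking along one scale sequence gives `θ(p_c) = 0`.** If for some strictly
increasing `s` the blocking probabilities `1 - P_{p_c}(annCross (s i) (s (i+1)))` are NOT summable,
then `PercolationContinuity d`. -/
theorem percolationContinuity_of_not_summable_blocking {s : ℕ → ℕ} (hs : StrictMono s)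
    (h : ¬ Summable (blocking (d := d) (criticalProbI d) s)) : PercolationContinuity d := by
  by_contra hne
  have hθ : 0 < theta (zdGraph d) 0 (criticalProbI d) :=
    lt_of_le_of_ne measureReal_nonneg (Ne.symm hne)
  exact h (summable_blocking_of_theta_pos _ hs hθ).1

/-- The `ℤ³` case. -/
theorem percolationContinuityZ3_of_not_summable_blocking {s : ℕ → ℕ} (hs : StrictMono s)
    (h : ¬ Summable (blocking (d := 3) (criticalProbI 3) s)) : PercolationContinuityZ3 :=
  percolationContinuity_of_not_summable_blocking hs h

end SurfaceTension

end Summit.CriticalPhenomena.PercolationContinuityZ3.Theorems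

end
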